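import Literature.MathematicalPhysics.QuantumFieldTheory.Balaban1983to89.B9Eq333ProjectionCovariance

/-!
# `Balaban1983to89.B9Eq387CubeProjectionGaugeCovariance` — T. Bałaban, *Propagators for lattice gauge theories in a background field*, Commun. Math. Phys.
# **99** (1985) 389–434 [Balaban1985BackgroundPropagators] Cor 3.6 p. 408 with (3.87)–(3.89) p. 409 and (3.28)–(3.33) pp. 395–396: **THE CUBE PROJECTION
# `R_□(U)` AND THE DIVERGENCE `D_U†` ARE GAUGE COVARIANT — `R_□(U^u)R(u) = R(u)R_□(U)`, `D_{U^u}†R(u) = R(u)D_U†`, hence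
# `‖D_{U^u}†(R(u)z) − R_□(U^u)(D_{U^u}†(R(u)z))‖ = ‖D_U†z − R_□(U)(D_U†z)‖`** — the gauge half of print's per-cube gauge reduction (Cor 3.6: «If a
# configuration U satisfies (3.35) … then Theorems 3.1–3.3 hold for the operators G′_□(U), …»; (3.33) «R(U^u) = R(u)R(U)R(u⁻¹)»), companion of
# `B9Eq387CubeProjectionLocality` (the locality half): route R2′ STEP B7′∕B8′, S-P6′, instance-ledger row L10 (loc) of the pub-balaban NE9 chain

statement-level skeleton of published theorems with citation tags; proofs where landed; nothing here is a claim about the Yang–Mills mass gap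

CITATION HEADER (lean-in-tree rule).  Audit cell `pub-balaban`, sub-cell `t4`, BINDER row NE9; filed by NE9 formalisation-swarm LEAF PROVER 05
(`b2b-balaban-t4-ne9-formalise-leaf-05`, gen 78) as a [folklore] COMPOSITION BY NAME of ne9-leaf-03's `B9Eq328GaugeAction` ((3.28): `gaugeU`, `gaugeW`, `AdW`,
`covLaplaceSiteK_gaugeU`, `covDivL2K_gaugeU`, `norm_gaugeW`, `inner_gaugeW_left`), `B9Eq333ProjectionCovariance` ((3.32)–(3.33): `QprimeW_gaugeU_eq_zero_iff`,
`inner_AdW_inv`; its `RofU_gaugeU` is the GLOBAL case `N = ⊤` of §2 below) and `B5Eq172FlatFibreNaturality.map_projR_of_intertwine` (an orthogonal projection of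
the shape (3.21) commutes with an intertwining adjoint pair), with `B11Eq103H1Complex.projR ∕ adjoint_covDerivL2K`.  CONSUMERS BY SHAPE: the cube projection
`projR Δ^η_U (Q′_U × N.mkQ)` of the S-P6′(β) chain (`B9Eq387CubeLocalisedProjectionLattice ∕ …Profile ∕ …Adjoint`) and the `hcmp` ∕ cube-form letters of
`B9Eq387CubeLocalisedProjection.cube_form_ge′` (S-P6′(γ)).  Source READ in the held text [Balaban1985BackgroundPropagators] (journal page = PDF page + 388):
p. 395 (3.28) «U → U^u, U^u(x,x′) = u(x)U(x,x′)u⁻¹(x′)», (3.31) «Δ^η_{U^u} = R(u)Δ^η_UR(u⁻¹)», (3.32), p. 396 (3.33) «R(U^u) = R(u)R(U)R(u⁻¹)»; p. 408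
Cor 3.6; p. 409 (3.87)–(3.89).  NOTHING of print's estimates is asserted or valued.

WHY (row L10, the (3.35)-class (loc)).  With `B9Eq387CubeProjectionLocality` (cube objects at `U^u` = cube objects at the globally small `Ũ := U^u` on `□⁺`,
`1` elsewhere) the cube-form inequality travels `Ũ → U^u`; THIS file carries it `U^u → U`: the cube projection with the support constraint `N_□` and the
divergence transform by the unitary `R(u)`, so every norm in the `hcmp` ∕ cube-form letters is the same at `U^u` on `R(u)z` and at `U` on `z`.

WHAT IS PROVED (sorry-free; proof lane — no `def`; [folklore]).
* §1 **`gaugeW_mem_iff_of_support`** — a support-defined submodule `N` (letter `hN`: site fields vanishing off the blocks of `Y`) is `R(u)`-invariant: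
  `R(u)f ∈ N ↔ f ∈ N`; `AdW_eq_zero_iff`.
* §2 **`cube_projR_gaugeU`** — for fibrewise isometric `R(u(x))` (`hAd`), with the S-P6′ letters `hN`, `hΔs`∕`hΔs′` (`Δ^η` at `U` and at `U^u`), `hQ′`∕`hQ″`
  (`Q′` at `U` and at `U^u`): `projR Δ^η_{U^u} (Q′_{U^u} × N.mkQ) (R(u)v) = R(u)(projR Δ^η_U (Q′_U × N.mkQ) v)`; **`cube_projR_gaugeU_conj`** — the printed
  shape `R_□(U^u) = R(u) R_□(U) R(u⁻¹)` as linear maps.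
* §3 **`adjoint_covDerivL2K_gaugeU`** — `D_{U^u}†(R(u)z) = R(u)(D_U†z)` (`R(u)` at the base point on bond fields), under `hRS` at `U` and at `U^u` (the
  latter is `B9Thm311GaugeOrbitClosed.hRS_gaugeU` from `hAd`; displayed here to keep the imports light); **`norm_sub_cube_projR_adjoint_gaugeU`** — the
  `hcmp`-side norms agree: `‖D_{U^u}†(R(u)z) − R_□(U^u)(D_{U^u}†(R(u)z))‖ = ‖D_U†z − R_□(U)(D_U†z)‖` and `‖D_{U^u}†(R(u)z)‖ = ‖D_U†z‖`.
HONEST SCOPE.  Conjugation algebra only: EVERY background, EVERY `𝔸ˣ`-valued gauge function with fibrewise isometric `R(u(x))`; no smallness, no window, no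
estimate; the `curl` ∕ `Q(U)` covariances are `B9Eq328GaugeAction.covCurlL2K_gaugeU` ∕ `B9Eq333ProjectionCovariance.QtorusW_gaugeU` (not restated); the axial
gauge itself (S-P4) and the `Q(U)`-locality are NOT here.  NOT NE9 (cell pub-balaban: NE9 NOT PRINTED ∕ NOT PROVED; «NE9 ⇐ the named binders»; row WALLED
ON A MODEL (O-NE9-1; #5 UNRULED); spine PROVED 0∕9; rung (B)+1 on a finite T⁴ — NOT infinite volume, NOT mass gap, NOT Clay; HONEST DEPENDENCY: continuum YM on
T⁴ ⇐ BetaPertH ∧ nine spine estimates (0/9 proved); BetaPertH ⇐ (D1) ∧ (D4) ∧ CAP+tail; G-an2-4 gates asym, D1 and NE2/3/4).  NEW file; nothing modified.  Net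
new unproved facts: 0.
-/

noncomputable section

set_option autoImplicit false

open scoped InnerProductSpace ComplexConjugate

namespace Literature.MathematicalPhysics.QuantumFieldTheory.Balaban1983to89.B9Eq387CubeProjectionGaugeCovariance

open B4Sect5Torus (TSite)
open B9SectCLatticeCarrier (Bond bpos)
open B9Eq311L2Pairing (WL2)
open B9Eq319QprimeTorus (fineP blockCoord)
open B11Eq103H1Complex (SiteL2K BondL2K covDerivL2K covDivL2K covLaplaceSiteK projR adjoint_covDerivL2K)
open B9Eq310HessianOperator (adTransportW)
open B9Eq326OperatorAssembly (QprimeW)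
open B9Eq328GaugeAction (gaugeU gaugeW AdW equiv_gaugeW gaugeW_inv_apply gaugeW_apply_inv gaugeU_inv_gaugeU covLaplaceSiteK_gaugeU covDivL2K_gaugeU
  inner_gaugeW_left norm_gaugeW AdW_inv_apply AdW_apply_inv)
open B9Eq333ProjectionCovariance (QprimeW_gaugeU_eq_zero_iff inner_AdW_inv)
open B5Eq172FlatFibreNaturality (map_projR_of_intertwine)

/-! ## §1 Support constraints are gauge invariant -/

section Support

variable {d : ℕ} (L : ℕ) [NeZero L] (m : Fin d → ℕ) {𝔸 : Type*} [Ring 𝔸] [Algebra ℂ 𝔸]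
  {W : Type*} [NormedAddCommGroup W] [InnerProductSpace ℂ W] (φ : W ≃ₗ[ℂ] 𝔸) {c₀ : ℝ}

omit [NeZero L] in
/-- `R(u)w = 0 ↔ w = 0` on the fibre (`R(u⁻¹)R(u) = 1`). [folklore] [cite: Balaban1985BackgroundPropagators, (3.28) p.395] -/
theorem AdW_eq_zero_iff (u : 𝔸ˣ) (w : W) : AdW φ u w = 0 ↔ w = 0 :=
  ⟨fun h => by rw [← AdW_inv_apply φ u w, h, map_zero], fun h => by rw [h, map_zero]⟩

omit [NeZero L] in
/-- **A SUPPORT-DEFINED CONSTRAINT `N_□` IS `R(u)`-INVARIANT**: with `N` = the site fields vanishing off the blocks of `Y` (letter `hN` of the S-P6′ chain),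
`R(u)f ∈ N ↔ f ∈ N` — `R(u)` acts pointwise and fibrewise injectively. [folklore] [cite: Balaban1985BackgroundPropagators, (3.28) p.395, (3.87) p.409] -/
theorem gaugeW_mem_iff_of_support (u : TSite d (fineP L m) → 𝔸ˣ) (Y : Set (TSite d m)) {N : Submodule ℂ (SiteL2K ℂ d (fineP L m) c₀ W)}
    (hN : ∀ f : SiteL2K ℂ d (fineP L m) c₀ W, f ∈ N ↔ ∀ x : TSite d (fineP L m), blockCoord L m x ∉ Y → WL2.equiv ℂ _ W f x = 0)
    (f : SiteL2K ℂ d (fineP L m) c₀ W) : gaugeW φ u f ∈ N ↔ f ∈ N := by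
  rw [hN, hN]
  refine forall_congr' fun x => forall_congr' fun _ => ?_
  rw [equiv_gaugeW, AdW_eq_zero_iff]

end Support

/-! ## §2 `R_□(U^u) R(u) = R(u) R_□(U)` -/

section Projection

variable {d : ℕ} (L : ℕ) [NeZero L] (m : Fin d → ℕ) {𝔸 : Type*} [Ring 𝔸] [Algebra ℂ 𝔸]
  {W : Type*} [NormedAddCommGroup W] [InnerProductSpace ℂ W] [FiniteDimensional ℂ W] (φ : W ≃ₗ[ℂ] 𝔸) {c₀ : ℝ} [Fact (0 < c₀)] {c₁ : ℝ} (η : ℝ)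
  {g : TSite d (fineP L m) → 𝔸ˣ} (U : Bond d (fineP L m) → 𝔸ˣ)
  (hAd : ∀ (x : TSite d (fineP L m)) (v v' : W), ⟪AdW φ (g x) v, AdW φ (g x) v'⟫_ℂ = ⟪v, v'⟫_ℂ)
  (Y : Set (TSite d m)) {N : Submodule ℂ (SiteL2K ℂ d (fineP L m) c₀ W)}
  (hN : ∀ f : SiteL2K ℂ d (fineP L m) c₀ W, f ∈ N ↔ ∀ x : TSite d (fineP L m), blockCoord L m x ∉ Y → WL2.equiv ℂ _ W f x = 0)
  (Δs Δs' : SiteL2K ℂ d (fineP L m) c₀ W →ₗ[ℂ] SiteL2K ℂ d (fineP L m) c₀ W)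
  (hΔs : Δs = covLaplaceSiteK ((η : ℂ))⁻¹ (adTransportW φ U) (adTransportW φ fun b => (U b)⁻¹))
  (hΔs' : Δs' = covLaplaceSiteK ((η : ℂ))⁻¹ (adTransportW φ (gaugeU g U)) (adTransportW φ fun b => (gaugeU g U b)⁻¹))
  (Q' Q'' : SiteL2K ℂ d (fineP L m) c₀ W →ₗ[ℂ] SiteL2K ℂ d m c₁ W)
  (hQ' : Q' = (WL2.linearEquiv ℂ ℂ (fun _ : TSite d m => c₁)).symm.toLinearMap ∘ₗ QprimeW L m φ U (c₀ := c₀))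
  (hQ'' : Q'' = (WL2.linearEquiv ℂ ℂ (fun _ : TSite d m => c₁)).symm.toLinearMap ∘ₗ QprimeW L m φ (gaugeU g U) (c₀ := c₀))

include hAd hN hΔs hΔs' hQ' hQ'' in
/-- **`R_□(U^u) R(u) = R(u) R_□(U)`** — the cube projection `projR Δ^η_U (Q′_U × N.mkQ)` (orthogonal projection onto `Δ^η_U(N(Q′(U)) ∩ N_□)`) is gauge
covariant: `R(u)` is unitary (`hAd`), intertwines `Δ^η_U ∕ Δ^η_{U^u}` ((3.31)), the averaging kernels ((3.32)) and the support constraint (§1), hence the two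
projections (`map_projR_of_intertwine`); (3.33) is the case `N = ⊤`. [cite: Balaban1985BackgroundPropagators, (3.33) p.396, (3.31)–(3.32) p.395, Cor 3.6 p.408, (3.87) p.409] -/
theorem cube_projR_gaugeU (v : SiteL2K ℂ d (fineP L m) c₀ W) :
    projR Δs' (Q''.prod N.mkQ) (gaugeW φ g v) = gaugeW φ g (projR Δs (Q'.prod N.mkQ) v) := by
  -- the kernels read through the letters
  have hk : ∀ (V : Bond d (fineP L m) → 𝔸ˣ) (Q : SiteL2K ℂ d (fineP L m) c₀ W →ₗ[ℂ] SiteL2K ℂ d m c₁ W),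
      Q = (WL2.linearEquiv ℂ ℂ (fun _ : TSite d m => c₁)).symm.toLinearMap ∘ₗ QprimeW L m φ V (c₀ := c₀) →
      ∀ f, (Q.prod N.mkQ) f = 0 ↔ QprimeW L m φ V (c₀ := c₀) f = 0 ∧ f ∈ N := fun V Q hQ f => by
    show (Q f, N.mkQ f) = 0 ↔ _
    rw [Prod.mk_eq_zero, Submodule.mkQ_apply, Submodule.Quotient.mk_eq_zero, hQ, LinearMap.comp_apply, LinearEquiv.coe_coe,
      LinearEquiv.map_eq_zero_iff]
  have hΔ' : ∀ f : SiteL2K ℂ d (fineP L m) c₀ W, gaugeW φ g (Δs f) = Δs' (gaugeW φ g f) := fun f => by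
    rw [hΔs, hΔs']; exact (covLaplaceSiteK_gaugeU φ _ g U f).symm
  have hΔ : ∀ a : SiteL2K ℂ d (fineP L m) c₀ W, gaugeW φ g⁻¹ (Δs' a) = Δs (gaugeW φ g⁻¹ a) := fun a => by
    have h := hΔ' (gaugeW φ g⁻¹ a)
    rw [gaugeW_apply_inv] at h
    rw [← h, gaugeW_inv_apply]
  have hQ1 : ∀ f : SiteL2K ℂ d (fineP L m) c₀ W, (Q'.prod N.mkQ) f = 0 → (Q''.prod N.mkQ) (gaugeW φ g f) = 0 := fun f hf => by
    rw [hk U Q' hQ'] at hf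
    rw [hk (gaugeU g U) Q'' hQ'']
    exact ⟨(QprimeW_gaugeU_eq_zero_iff L m φ g U f).2 hf.1, (gaugeW_mem_iff_of_support L m φ g Y hN f).2 hf.2⟩
  have hQ2 : ∀ a : SiteL2K ℂ d (fineP L m) c₀ W, (Q''.prod N.mkQ) a = 0 → (Q'.prod N.mkQ) (gaugeW φ g⁻¹ a) = 0 := fun a ha => by
    rw [hk (gaugeU g U) Q'' hQ''] at ha
    rw [hk U Q' hQ']
    have h := (QprimeW_gaugeU_eq_zero_iff L m φ g⁻¹ (gaugeU g U) a).2 ha.1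
    rw [gaugeU_inv_gaugeU] at h
    exact ⟨h, (gaugeW_mem_iff_of_support L m φ g⁻¹ Y hN a).2 ha.2⟩
  have hadj : ∀ (a f : SiteL2K ℂ d (fineP L m) c₀ W), ⟪a, gaugeW φ g f⟫_ℂ = ⟪gaugeW φ g⁻¹ a, f⟫_ℂ := fun a f => by
    rw [inner_gaugeW_left φ g⁻¹ (inner_AdW_inv L m φ hAd), inv_inv]
  exact (map_projR_of_intertwine Δs' (Q''.prod N.mkQ) Δs (Q'.prod N.mkQ) (gaugeW φ g⁻¹) (gaugeW φ g) hadj hΔ hΔ' hQ2 hQ1 v).symm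

include hAd hN hΔs hΔs' hQ' hQ'' in
/-- The printed shape: **`R_□(U^u) = R(u) R_□(U) R(u⁻¹)`** as an equality of linear maps. [cite: Balaban1985BackgroundPropagators, (3.33) p.396, Cor 3.6 p.408] -/
theorem cube_projR_gaugeU_conj : projR Δs' (Q''.prod N.mkQ) = gaugeW φ g ∘ₗ projR Δs (Q'.prod N.mkQ) ∘ₗ gaugeW φ g⁻¹ := by
  apply LinearMap.ext
  intro v
  rw [LinearMap.comp_apply, LinearMap.comp_apply, ← cube_projR_gaugeU L m φ η U hAd Y hN Δs Δs' hΔs hΔs' Q' Q'' hQ' hQ'', gaugeW_apply_inv]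

end Projection

/-! ## §3 `D_{U^u}† R(u) = R(u) D_U†` and the `hcmp`-side norms -/

section Adjoint

variable {d : ℕ} (L : ℕ) [NeZero L] (m : Fin d → ℕ) {𝔸 : Type*} [Ring 𝔸] [Algebra ℂ 𝔸]
  {W : Type*} [NormedAddCommGroup W] [InnerProductSpace ℂ W] [FiniteDimensional ℂ W] (φ : W ≃ₗ[ℂ] 𝔸) {c₀ : ℝ} [Fact (0 < c₀)] {c₁ : ℝ} (η : ℝ)
  {g : TSite d (fineP L m) → 𝔸ˣ} (U : Bond d (fineP L m) → 𝔸ˣ)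
  (hRS : ∀ (b : Bond d (fineP L m)) (v u : W), ⟪adTransportW φ U b v, u⟫_ℂ = ⟪v, adTransportW φ (fun b => (U b)⁻¹) b u⟫_ℂ)
  (hRS' : ∀ (b : Bond d (fineP L m)) (v u : W),
    ⟪adTransportW φ (gaugeU g U) b v, u⟫_ℂ = ⟪v, adTransportW φ (fun b => (gaugeU g U b)⁻¹) b u⟫_ℂ)

include hRS hRS' in
omit [NeZero L] in
/-- **`D_{U^u}†(R(u)z) = R(u)(D_U†z)`** — `D† = D*` for each background ((3.8), `adjoint_covDerivL2K` under `hRS` ∕ `hRS′`; `hRS′` is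
`B9Thm311GaugeOrbitClosed.hRS_gaugeU` from `hAd`) and (3.8) is covariant (`covDivL2K_gaugeU`, `R(u)` at the base point on bond fields).
[cite: Balaban1985BackgroundPropagators, (3.8) p.392, (3.28) p.395, (3.31) p.395] -/
theorem adjoint_covDerivL2K_gaugeU (z : BondL2K ℂ d (fineP L m) c₀ W) :
    LinearMap.adjoint (covDerivL2K ℂ c₀ ((η : ℂ))⁻¹ (adTransportW φ (gaugeU g U))) (gaugeW φ (fun b : Bond d (fineP L m) => g (bpos b)) z) =
      gaugeW φ g (LinearMap.adjoint (covDerivL2K ℂ c₀ ((η : ℂ))⁻¹ (adTransportW φ U)) z) := by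
  have hc : conj (((η : ℂ))⁻¹) = ((η : ℂ))⁻¹ := by rw [map_inv₀, Complex.conj_ofReal]
  rw [adjoint_covDerivL2K ((η : ℂ))⁻¹ hc _ _ hRS', adjoint_covDerivL2K ((η : ℂ))⁻¹ hc _ _ hRS]
  exact covDivL2K_gaugeU φ _ g U z

variable (hAd : ∀ (x : TSite d (fineP L m)) (v v' : W), ⟪AdW φ (g x) v, AdW φ (g x) v'⟫_ℂ = ⟪v, v'⟫_ℂ)
  (Y : Set (TSite d m)) {N : Submodule ℂ (SiteL2K ℂ d (fineP L m) c₀ W)}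
  (hN : ∀ f : SiteL2K ℂ d (fineP L m) c₀ W, f ∈ N ↔ ∀ x : TSite d (fineP L m), blockCoord L m x ∉ Y → WL2.equiv ℂ _ W f x = 0)
  (Δs Δs' : SiteL2K ℂ d (fineP L m) c₀ W →ₗ[ℂ] SiteL2K ℂ d (fineP L m) c₀ W)
  (hΔs : Δs = covLaplaceSiteK ((η : ℂ))⁻¹ (adTransportW φ U) (adTransportW φ fun b => (U b)⁻¹))
  (hΔs' : Δs' = covLaplaceSiteK ((η : ℂ))⁻¹ (adTransportW φ (gaugeU g U)) (adTransportW φ fun b => (gaugeU g U b)⁻¹))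
  (Q' Q'' : SiteL2K ℂ d (fineP L m) c₀ W →ₗ[ℂ] SiteL2K ℂ d m c₁ W)
  (hQ' : Q' = (WL2.linearEquiv ℂ ℂ (fun _ : TSite d m => c₁)).symm.toLinearMap ∘ₗ QprimeW L m φ U (c₀ := c₀))
  (hQ'' : Q'' = (WL2.linearEquiv ℂ ℂ (fun _ : TSite d m => c₁)).symm.toLinearMap ∘ₗ QprimeW L m φ (gaugeU g U) (c₀ := c₀))
  (D D' : SiteL2K ℂ d (fineP L m) c₀ W →ₗ[ℂ] BondL2K ℂ d (fineP L m) c₀ W)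
  (hD : D = covDerivL2K ℂ c₀ ((η : ℂ))⁻¹ (adTransportW φ U)) (hD' : D' = covDerivL2K ℂ c₀ ((η : ℂ))⁻¹ (adTransportW φ (gaugeU g U)))

include hRS hRS' hAd hN hΔs hΔs' hQ' hQ'' hD hD' in
/-- **THE `hcmp`-SIDE NORMS AGREE AT `U^u` ON `R(u)z` AND AT `U` ON `z`**: with the S-P6′ letters at `U` and at `U^u` (`hΔs`, `hQ′`, `hD` and primed),
`‖D′†(R(u)z) − projR Δs′ (Q″ × N.mkQ) (D′†(R(u)z))‖ = ‖D†z − projR Δs (Q′ × N.mkQ) (D†z)‖` and `‖D′†(R(u)z)‖ = ‖D†z‖` — §2 + §3 + `‖R(u)f‖ = ‖f‖`.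
The remaining letter of (γ)'s `hcmp` at `U^u`, `‖D′†w − R(U^u)(D′†w)‖`, is (3.33) itself (`B9Eq333ProjectionCovariance.RofU_gaugeU`).
[cite: Balaban1985BackgroundPropagators, Cor 3.6 p.408, (3.87)–(3.89) p.409, (3.33) p.396] -/
theorem norm_sub_cube_projR_adjoint_gaugeU (z : BondL2K ℂ d (fineP L m) c₀ W) :
    ‖LinearMap.adjoint D' (gaugeW φ (fun b : Bond d (fineP L m) => g (bpos b)) z) -
        projR Δs' (Q''.prod N.mkQ) (LinearMap.adjoint D' (gaugeW φ (fun b : Bond d (fineP L m) => g (bpos b)) z))‖ =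
      ‖LinearMap.adjoint D z - projR Δs (Q'.prod N.mkQ) (LinearMap.adjoint D z)‖ ∧
    ‖LinearMap.adjoint D' (gaugeW φ (fun b : Bond d (fineP L m) => g (bpos b)) z)‖ = ‖LinearMap.adjoint D z‖ := by
  rw [hD, hD', adjoint_covDerivL2K_gaugeU L m φ η U hRS hRS' z, cube_projR_gaugeU L m φ η U hAd Y hN Δs Δs' hΔs hΔs' Q' Q'' hQ' hQ'',
    ← map_sub, norm_gaugeW φ g hAd, norm_gaugeW φ g hAd]
  exact ⟨rfl, rfl⟩

end Adjoint

end Literature.MathematicalPhysics.QuantumFieldTheory.Balaban1983to89.B9Eq387CubeProjectionGaugeCovariance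

end
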